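import Literature.AlgebraicGeometry.ModuliOfAbelianVarieties.SiegelCMLatticeReciprocity
import HarnessLib

/-!
# The torsion clause of the moduli reading: `a⁻¹·v̂ ≡ (r·a)⁻¹·ŵ (mod ẑ^{2g})` read in `F = ∏ᵢ Kᵢ` is Shimura's (18.3a)
# `tᵢ · (uᵢ mod 𝔞ᵢ) = wᵢ mod tᵢ𝔞ᵢ`, factorwise ([Shimura 1998] §18.3 (18.3a), Thm. 18.6 (2); [Milne 2005] Thm. 6.11, (63), Thm. 11.2)

Topic `AlgebraicGeometry/ModuliOfAbelianVarieties`; namespace `Literature.AlgebraicGeometry.ModuliOfAbelianVarieties.CMStructure`.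
Cell hodgecm-mathlib (D-0151), #60 road (row I-7 `SiegelS1`; lead A-p05, MUMFORD-LINE-SPEC §3/§8, next-shift item M3a
`hmod_of_isModuli`).  THEOREMS ONLY: no definition, no named fact, no instance, no `sorry` (net Literature debt 0).  A banked
GENERIC leaf (director s86 (2)(b)); HC_CM is proved only modulo the printed citations until rung 0 closes.  Sequel of ★ R60-35
`SiegelCMLatticeReciprocity` (same setting, same hypotheses `hr`, `h𝔞`, `ha`).

## Setting and what is proved

`c : CMStructure g δ ι K` (★ (σ4)-D), `v ∈ ℚ^{2g}`, `a, r ∈ GL_{2g}(𝔸_{ℚ,f})` with `(r : matrix) = R(t) = c.cmRepMatrix t` for a tuple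
of finite idèles `t = (tᵢ)`, and the adelic lattice of `a` read in `∏ᵢ 𝔸_{Kᵢ,f}` through `u ↦ R(u)·(v ⊗ 1)` equal to `∏ᵢ 𝔞̂ᵢ`
(hypothesis `ha`, exactly as in ★ R60-35).  The MODULI READING of a `ℚ`-model of the Siegel tower ([Milne2005ShimuraVarieties]
Thm. 6.11, (63), Prop. 14.12; the cell's T1′ «`IsModuli`») compares the level structures of the points `[J, a]` and `[J, r·a]`
through the TORSION CLAUSE «for all `v′, w′ ∈ ℚ^{2g}` with `a⁻¹·v̂′ − (r·a)⁻¹·ŵ′ ∈ ẑ^{2g}`: `f((u_a v′)^σ) = u_{ra}(w′)`», while the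
main theorem of complex multiplication (★ row II-1 `shimura1998_thm18_6`, its isogeny forms ★ R60-28/28b/37) speaks through
Shimura's (18.3a) «`t·(u mod 𝔞) = w (mod t𝔞)`» = ★ `IdeleAction.ideleMulEquiv t 𝔞 _ (mk u) = mk w`, one CM field at a time.
This file is the dictionary between the two clauses:

* §1 `cmRepMatrix_add` / `cmRepMatrix_sub` — `R` is additive (it is an algebra homomorphism, ★ R60-1 `cmRepMatrix_eq_algHom`).
* §2 `inv_mulVec_sub_mul_inv_mulVec` — the one-line identity `a⁻¹·R(u)·v̂ − (r·a)⁻¹·R(w)·v̂ = (r·a)⁻¹·R(t·u − w)·v̂` (`u, w` adelic).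
* §3 **`forall_inv_mulVec_sub_mem_iff`** (adelic form) — `a⁻¹R(u)v̂ ≡ (ra)⁻¹R(w)v̂ (mod ẑ^{2g}) ↔ ∀ i, wᵢ − tᵢuᵢ ∈ (tᵢ𝔞ᵢ)^` (★ R60-35
  `forall_mulVec_inv_mul_mem_iff` at the adelic element `t·u − w`).
* §4 **`forall_inv_mulVec_act_sub_mem_iff_ideleMulEquiv`** (rational form, THE HEAD) — for `u, w ∈ F`:
  `a⁻¹·(act(u)·v)^ ≡ (r·a)⁻¹·(act(w)·v)^ (mod ẑ^{2g}) ↔ ∀ i, tᵢ·(uᵢ mod 𝔞ᵢ) = wᵢ mod tᵢ𝔞ᵢ` (★ `ideleMulEquiv_mk_eq_mk_iff` = (18.3a)).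
* §5 `…_of_coe_eq_cmRecipMatrix` — the same for the reciprocity element of ★ `SiegelRationalModel.IsCanonical`
  (`(r : matrix) = c.cmRecipMatrix Φ E s`, `tᵢ = N_{E,Φᵢ}(s)` = ★ `reflexNormFiniteIdele`), Milne's normalisation (no inverse).
* §6 `forall_imp_iff_forall_act_imp_of_bijective` — for a CYCLIC vector `v` (`x ↦ act(x)·v` bijective, ★ R60-14) a clause
  quantified over `v′, w′ ∈ ℚ^{2g}` under the adelic congruence is the same clause quantified over `u, w ∈ F` under (18.3a).

NOT here (honest scope): lattices `Λ_a` that are not `∏ 𝓞_{Kᵢ}`-modules (CM by an order) — there the hypothesis `ha` holds only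
for a sandwiching product lattice and the clause is transported along an isogeny ([Deligne1971TravauxShimura] 4.19; ★ R60-37);
the level-`K` variant with `k·a⁻¹`, `k ∈ K_δ(N)` (for (62) one takes `k = 1`).

## References
* [Shimura1998] G. Shimura, *Abelian Varieties with Complex Multiplication and Modular Functions* (1998), §18.3 (18.3a) pp. 122–123;
  §18.6 Thm. 18.6 (2) pp. 124–125.
* [Milne2005ShimuraVarieties] J. S. Milne, *Introduction to Shimura varieties* (2005), §4 pp. 48–49; §6 Thm. 6.11; §11 Thm. 11.2 p. 108;
  §12 Def. 12.8 (60)–(63) pp. 114–116; §14 Prop. 14.12 p. 125.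
* [Deligne1971TravauxShimura] P. Deligne, *Travaux de Shimura*, Sém. Bourbaki 389 (1971), 3.9 p. 140, 4.18–4.21 pp. 150–152.
-/

set_option autoImplicit false

noncomputable section

open Module Function NumberField Matrix IsDedekindDomain
open scoped TensorProduct nonZeroDivisors

namespace Literature.AlgebraicGeometry.ModuliOfAbelianVarieties

namespace CMStructure

open Literature.AlgebraicGeometry.Motives (CMType)
open Literature.NumberTheory.ComplexMultiplication (traceField ratFiniteAdeleTensorEquiv reflexNormFiniteIdele)
open Literature.NumberTheory.Automorphic (integralFiniteAdeles)
open Literature.NumberTheory.NumberFields.IdeleAction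
  (idealAdeles ideleMulIdeal ideleMulEquiv ideleMulEquiv_mk_eq_mk_iff)

variable {g : ℕ} {δ : Fin g → ℕ} {ι : Type} [Fintype ι] [DecidableEq ι] {K : ι → Type} [∀ i, Field (K i)]
  [∀ i, NumberField (K i)] [∀ i, IsCMField (K i)] (c : CMStructure g δ ι K)

/-! ### §1. `R = cmRepMatrix` is additive -/

/-- **`R(t + u) = R(t) + R(u)`** — the adelic representation of `F ⊗ 𝔸_{ℚ,f} = ∏ᵢ 𝔸_{Kᵢ,f}` on `𝔸_{ℚ,f}^{2g}` through `act` is additive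
(it is an algebra homomorphism, ★ `cmRepMatrix_eq_algHom`). [cite: Deligne1971TravauxShimura, 3.9 p. 140 and 4.18 p. 150] -/
theorem cmRepMatrix_add (t u : Π i, FiniteAdeleRing (𝓞 (K i)) (K i)) :
    c.cmRepMatrix (t + u) = c.cmRepMatrix t + c.cmRepMatrix u := by
  obtain ⟨Θ, hΘ⟩ := c.exists_algHom_extending_actMatrix
  rw [c.cmRepMatrix_eq_algHom Θ hΘ, c.cmRepMatrix_eq_algHom Θ hΘ, c.cmRepMatrix_eq_algHom Θ hΘ, ← map_add]
  congr 1
  funext i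
  rw [Pi.add_apply, Pi.add_apply, map_add]

/-- **`R(t − u) = R(t) − R(u)`.** [cite: Deligne1971TravauxShimura, 3.9 p. 140 and 4.18 p. 150] -/
theorem cmRepMatrix_sub (t u : Π i, FiniteAdeleRing (𝓞 (K i)) (K i)) :
    c.cmRepMatrix (t - u) = c.cmRepMatrix t - c.cmRepMatrix u := by
  obtain ⟨Θ, hΘ⟩ := c.exists_algHom_extending_actMatrix
  rw [c.cmRepMatrix_eq_algHom Θ hΘ, c.cmRepMatrix_eq_algHom Θ hΘ, c.cmRepMatrix_eq_algHom Θ hΘ, ← map_sub]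
  congr 1
  funext i
  rw [Pi.sub_apply, Pi.sub_apply, map_sub]

/-! ### §2. The difference `a⁻¹·R(u)·v̂ − (r·a)⁻¹·R(w)·v̂` -/

/-- **`a⁻¹·R(u)·x − (r·a)⁻¹·R(w)·x = (r·a)⁻¹·R(t·u − w)·x`** for `(r : matrix) = R(t)` and any `x ∈ 𝔸_{ℚ,f}^{2g}`, `u, w ∈ ∏ᵢ 𝔸_{Kᵢ,f}`:
`a⁻¹ = (r·a)⁻¹·r` and `R` is multiplicative and additive. [cite: Deligne1971TravauxShimura, 3.9 p. 140] [cite: Shimura1998, §18.3 pp. 122–123] -/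
theorem inv_mulVec_sub_mul_inv_mulVec {a r : GL (Fin g ⊕ Fin g) finAdeleQ} {t : Π i, (FiniteAdeleRing (𝓞 (K i)) (K i))ˣ}
    (hr : ((r : GL (Fin g ⊕ Fin g) finAdeleQ) : Matrix (Fin g ⊕ Fin g) (Fin g ⊕ Fin g) finAdeleQ) =
      c.cmRepMatrix fun i => (t i : FiniteAdeleRing (𝓞 (K i)) (K i)))
    (u w : Π i, FiniteAdeleRing (𝓞 (K i)) (K i)) (x : Fin g ⊕ Fin g → finAdeleQ) :
    ((a⁻¹ : GL (Fin g ⊕ Fin g) finAdeleQ) : Matrix (Fin g ⊕ Fin g) (Fin g ⊕ Fin g) finAdeleQ) *ᵥ (c.cmRepMatrix u *ᵥ x) -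
        (((r * a)⁻¹ : GL (Fin g ⊕ Fin g) finAdeleQ) : Matrix (Fin g ⊕ Fin g) (Fin g ⊕ Fin g) finAdeleQ) *ᵥ
          (c.cmRepMatrix w *ᵥ x) =
      (((r * a)⁻¹ : GL (Fin g ⊕ Fin g) finAdeleQ) : Matrix (Fin g ⊕ Fin g) (Fin g ⊕ Fin g) finAdeleQ) *ᵥ
        (c.cmRepMatrix ((fun i => (t i : FiniteAdeleRing (𝓞 (K i)) (K i))) * u - w) *ᵥ x) := by
  have hainv : ((a⁻¹ : GL (Fin g ⊕ Fin g) finAdeleQ) : Matrix (Fin g ⊕ Fin g) (Fin g ⊕ Fin g) finAdeleQ) =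
      (((r * a)⁻¹ : GL (Fin g ⊕ Fin g) finAdeleQ) : Matrix (Fin g ⊕ Fin g) (Fin g ⊕ Fin g) finAdeleQ) *
        c.cmRepMatrix fun i => (t i : FiniteAdeleRing (𝓞 (K i)) (K i)) := by
    rw [← hr, _root_.mul_inv_rev, Units.val_mul, Matrix.mul_assoc, Units.inv_mul, Matrix.mul_one]
  rw [hainv, ← Matrix.mulVec_mulVec, ← c.cmRepMatrix_mul_mulVec, ← Matrix.mulVec_sub, ← Matrix.sub_mulVec,
    ← c.cmRepMatrix_sub]

/-! ### §3. Adelic form: the congruence `mod ẑ^{2g}` is `wᵢ − tᵢuᵢ ∈ (tᵢ𝔞ᵢ)^`, factorwise -/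

/-- **`a⁻¹·R(u)·(v ⊗ 1) ≡ (r·a)⁻¹·R(w)·(v ⊗ 1) (mod ẑ^{2g}) ↔ ∀ i, wᵢ − tᵢuᵢ ∈ (tᵢ𝔞ᵢ)^`** for adelic `u, w ∈ ∏ᵢ 𝔸_{Kᵢ,f}`, under
`(r : matrix) = R(t)` and the adelic lattice hypothesis `ha` on `a` (★ R60-35 `forall_mulVec_inv_mul_mem_iff` at `t·u − w`; the adelic
lattice `(t𝔞)^` is ★ `IdeleAction.idealAdeles (ideleMulIdeal t 𝔞)`). [cite: Shimura1998, §18.3 (18.3a) pp. 122–123]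
[cite: Milne2005ShimuraVarieties, §4 pp. 48–49; Def. 12.8 (60)–(63) pp. 114–116] -/
theorem forall_inv_mulVec_sub_mem_iff {v : Fin g ⊕ Fin g → ℚ} {a r : GL (Fin g ⊕ Fin g) finAdeleQ}
    {t : Π i, (FiniteAdeleRing (𝓞 (K i)) (K i))ˣ}
    (hr : ((r : GL (Fin g ⊕ Fin g) finAdeleQ) : Matrix (Fin g ⊕ Fin g) (Fin g ⊕ Fin g) finAdeleQ) =
      c.cmRepMatrix fun i => (t i : FiniteAdeleRing (𝓞 (K i)) (K i)))
    {𝔞 : Π i, FractionalIdeal (𝓞 (K i))⁰ (K i)} (h𝔞 : ∀ i, 𝔞 i ≠ 0)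
    (ha : ∀ u : Π i, FiniteAdeleRing (𝓞 (K i)) (K i),
      (∀ j, (((a⁻¹ : GL (Fin g ⊕ Fin g) finAdeleQ) : Matrix (Fin g ⊕ Fin g) (Fin g ⊕ Fin g) finAdeleQ) *ᵥ
          (c.cmRepMatrix u *ᵥ fun j => algebraMap ℚ finAdeleQ (v j))) j ∈ integralFiniteAdeles ℚ) ↔
        ∀ i, u i ∈ idealAdeles (𝔞 i))
    (u w : Π i, FiniteAdeleRing (𝓞 (K i)) (K i)) :
    (∀ j, (((a⁻¹ : GL (Fin g ⊕ Fin g) finAdeleQ) : Matrix (Fin g ⊕ Fin g) (Fin g ⊕ Fin g) finAdeleQ) *ᵥ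
              (c.cmRepMatrix u *ᵥ fun j => algebraMap ℚ finAdeleQ (v j)) -
            (((r * a)⁻¹ : GL (Fin g ⊕ Fin g) finAdeleQ) : Matrix (Fin g ⊕ Fin g) (Fin g ⊕ Fin g) finAdeleQ) *ᵥ
              (c.cmRepMatrix w *ᵥ fun j => algebraMap ℚ finAdeleQ (v j))) j ∈ integralFiniteAdeles ℚ) ↔
      ∀ i, w i - (t i : FiniteAdeleRing (𝓞 (K i)) (K i)) * u i ∈ idealAdeles (ideleMulIdeal (t i) (𝔞 i)) := by
  rw [c.inv_mulVec_sub_mul_inv_mulVec hr, c.forall_mulVec_inv_mul_mem_iff hr h𝔞 ha]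
  refine forall_congr' fun i => ?_
  rw [← neg_mem_iff, Pi.sub_apply, Pi.mul_apply, neg_sub]

/-! ### §4. Rational form: the torsion clause of the moduli reading IS (18.3a), factorwise -/

/-- **THE TORSION CLAUSE READ IN `F`.**  For `u, w ∈ F = ∏ᵢ Kᵢ` put `v′ = act(u)·v`, `w′ = act(w)·v`.  Under `(r : matrix) = R(t)` and
the adelic lattice hypothesis `ha` («the lattice of `[J, a]` read in `F` through `v` is `∏ᵢ 𝔞ᵢ`»):
`a⁻¹·v̂′ − (r·a)⁻¹·ŵ′ ∈ ẑ^{2g}` — the relation «`η_a(v′)^σ` and `η_{ra}(w′)` name the same torsion point» of the moduli reading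
([Milne2005ShimuraVarieties] Thm. 6.11, (63); the cell's T1′ `AdelicCongr (a⁻¹) ((r·a)⁻¹) v′ w′`) — holds iff for every factor `i`
Shimura's (18.3a) `tᵢ · (uᵢ mod 𝔞ᵢ) = wᵢ mod tᵢ𝔞ᵢ` holds (★ `IdeleAction.ideleMulEquiv`), the clause in which ★ `shimura1998_thm18_6` (2)
and its isogeny forms ★ R60-28/28b/37 are stated. [cite: Shimura1998, §18.3 (18.3a) pp. 122–123; §18.6 Thm. 18.6 (2) pp. 124–125]
[cite: Milne2005ShimuraVarieties, §6 Thm. 6.11; §12 (63) p. 116; §11 Thm. 11.2 p. 108] [cite: Deligne1971TravauxShimura, 4.19–4.21 pp. 151–152] -/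
theorem forall_inv_mulVec_act_sub_mem_iff_ideleMulEquiv {v : Fin g ⊕ Fin g → ℚ} {a r : GL (Fin g ⊕ Fin g) finAdeleQ}
    {t : Π i, (FiniteAdeleRing (𝓞 (K i)) (K i))ˣ}
    (hr : ((r : GL (Fin g ⊕ Fin g) finAdeleQ) : Matrix (Fin g ⊕ Fin g) (Fin g ⊕ Fin g) finAdeleQ) =
      c.cmRepMatrix fun i => (t i : FiniteAdeleRing (𝓞 (K i)) (K i)))
    {𝔞 : Π i, FractionalIdeal (𝓞 (K i))⁰ (K i)} (h𝔞 : ∀ i, 𝔞 i ≠ 0)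
    (ha : ∀ u : Π i, FiniteAdeleRing (𝓞 (K i)) (K i),
      (∀ j, (((a⁻¹ : GL (Fin g ⊕ Fin g) finAdeleQ) : Matrix (Fin g ⊕ Fin g) (Fin g ⊕ Fin g) finAdeleQ) *ᵥ
          (c.cmRepMatrix u *ᵥ fun j => algebraMap ℚ finAdeleQ (v j))) j ∈ integralFiniteAdeles ℚ) ↔
        ∀ i, u i ∈ idealAdeles (𝔞 i))
    (u w : Π i, K i) :
    (∀ j, (((a⁻¹ : GL (Fin g ⊕ Fin g) finAdeleQ) : Matrix (Fin g ⊕ Fin g) (Fin g ⊕ Fin g) finAdeleQ) *ᵥ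
              (fun j => algebraMap ℚ finAdeleQ (c.act u v j)) -
            (((r * a)⁻¹ : GL (Fin g ⊕ Fin g) finAdeleQ) : Matrix (Fin g ⊕ Fin g) (Fin g ⊕ Fin g) finAdeleQ) *ᵥ
              (fun j => algebraMap ℚ finAdeleQ (c.act w v j))) j ∈ integralFiniteAdeles ℚ) ↔
      ∀ i, ideleMulEquiv (t i) (𝔞 i) (h𝔞 i) (Submodule.Quotient.mk (u i)) = Submodule.Quotient.mk (w i) := by
  have hu : (fun j => algebraMap ℚ finAdeleQ (c.act u v j)) =
      c.cmRepMatrix (fun i => algebraMap (K i) (FiniteAdeleRing (𝓞 (K i)) (K i)) (u i)) *ᵥ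
        fun j => algebraMap ℚ finAdeleQ (v j) :=
    (c.cmRepMatrix_algebraMap_mulVec_algebraMap u v).symm
  have hw : (fun j => algebraMap ℚ finAdeleQ (c.act w v j)) =
      c.cmRepMatrix (fun i => algebraMap (K i) (FiniteAdeleRing (𝓞 (K i)) (K i)) (w i)) *ᵥ
        fun j => algebraMap ℚ finAdeleQ (v j) :=
    (c.cmRepMatrix_algebraMap_mulVec_algebraMap w v).symm
  rw [hu, hw, c.forall_inv_mulVec_sub_mem_iff hr h𝔞 ha]
  refine forall_congr' fun i => ?_
  rw [ideleMulEquiv_mk_eq_mk_iff]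

/-! ### §5. The reciprocity element of ★ `IsCanonical`: `tᵢ = N_{E,Φᵢ}(s)` -/

/-- **The torsion clause for the RECIPROCITY ELEMENT `r(s)`** (matrix `c.cmRecipMatrix Φ E s`, the binder of ★
`SiegelRationalModel.IsCanonical`): `a⁻¹·(act(u)·v)^ ≡ (r(s)·a)⁻¹·(act(w)·v)^ (mod ẑ^{2g}) ↔ ∀ i, N_{E,Φᵢ}(s)·(uᵢ mod 𝔞ᵢ) = wᵢ mod N_{E,Φᵢ}(s)𝔞ᵢ`
— Milne's normalisation (62)/(63) with Thm. 11.2 «`α(N_Φ(s)·x) = σx`» (NO inverse; ★ R60-22/28b read [Shimura1998] Thm. 18.6 under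
`IsArtinCorrespondent` with the idèle `g(N_{E/K*}(1_∞, t))`). [cite: Milne2005ShimuraVarieties, Thm. 11.2 p. 108; Def. 12.8 (62)–(63) pp. 114–116]
[cite: Shimura1998, §18.3 (18.3a) pp. 122–123; Thm. 18.6 (2) pp. 124–125] -/
theorem forall_inv_mulVec_act_sub_mem_iff_ideleMulEquiv_of_coe_eq_cmRecipMatrix {v : Fin g ⊕ Fin g → ℚ}
    {a r : GL (Fin g ⊕ Fin g) finAdeleQ} (Φ : ∀ i, CMType (K i)) (E : IntermediateField ℚ ℂ) [NumberField ↥E]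
    (s : (FiniteAdeleRing (𝓞 ↥E) ↥E)ˣ)
    (hr : ((r : GL (Fin g ⊕ Fin g) finAdeleQ) : Matrix (Fin g ⊕ Fin g) (Fin g ⊕ Fin g) finAdeleQ) = c.cmRecipMatrix Φ E s)
    {𝔞 : Π i, FractionalIdeal (𝓞 (K i))⁰ (K i)} (h𝔞 : ∀ i, 𝔞 i ≠ 0)
    (ha : ∀ u : Π i, FiniteAdeleRing (𝓞 (K i)) (K i),
      (∀ j, (((a⁻¹ : GL (Fin g ⊕ Fin g) finAdeleQ) : Matrix (Fin g ⊕ Fin g) (Fin g ⊕ Fin g) finAdeleQ) *ᵥ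
          (c.cmRepMatrix u *ᵥ fun j => algebraMap ℚ finAdeleQ (v j))) j ∈ integralFiniteAdeles ℚ) ↔
        ∀ i, u i ∈ idealAdeles (𝔞 i))
    (u w : Π i, K i) :
    (∀ j, (((a⁻¹ : GL (Fin g ⊕ Fin g) finAdeleQ) : Matrix (Fin g ⊕ Fin g) (Fin g ⊕ Fin g) finAdeleQ) *ᵥ
              (fun j => algebraMap ℚ finAdeleQ (c.act u v j)) -
            (((r * a)⁻¹ : GL (Fin g ⊕ Fin g) finAdeleQ) : Matrix (Fin g ⊕ Fin g) (Fin g ⊕ Fin g) finAdeleQ) *ᵥ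
              (fun j => algebraMap ℚ finAdeleQ (c.act w v j))) j ∈ integralFiniteAdeles ℚ) ↔
      ∀ i, ideleMulEquiv (reflexNormFiniteIdele (K i) (Φ i) E s) (𝔞 i) (h𝔞 i) (Submodule.Quotient.mk (u i)) =
        Submodule.Quotient.mk (w i) :=
  c.forall_inv_mulVec_act_sub_mem_iff_ideleMulEquiv (t := fun i => reflexNormFiniteIdele (K i) (Φ i) E s) hr h𝔞 ha u w

/-! ### §6. Quantifying over `ℚ^{2g}` versus over `F` through a cyclic vector -/

omit [DecidableEq ι] in
/-- **Repackaging along a cyclic vector.**  If `x ↦ act(x)·v : F → ℚ^{2g}` is bijective (★ R60-14: such `v` exist), a clause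
«for all `v′, w′ ∈ ℚ^{2g}`, `C v′ w′ → P v′ w′`» is the clause «for all `u, w ∈ F`, `C (act(u)·v) (act(w)·v) → P (act(u)·v) (act(w)·v)`» —
the form in which §4 turns the torsion clause of the moduli reading into the factorwise (18.3a) clauses.
[cite: Shimura1998, §5.1 Prop. 1 p. 36; §18.3 (18.3a) p. 122] [cite: Milne2005ShimuraVarieties, §6 Thm. 6.11] -/
theorem forall_imp_iff_forall_act_imp_of_bijective {v : Fin g ⊕ Fin g → ℚ}
    (hv : Function.Bijective fun x : Π i, K i => c.act x v)
    (C P : (Fin g ⊕ Fin g → ℚ) → (Fin g ⊕ Fin g → ℚ) → Prop) :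
    (∀ v' w' : Fin g ⊕ Fin g → ℚ, C v' w' → P v' w') ↔
      ∀ u w : Π i, K i, C (c.act u v) (c.act w v) → P (c.act u v) (c.act w v) := by
  refine ⟨fun h u w => h _ _, fun h v' w' hC => ?_⟩
  obtain ⟨u, rfl⟩ := hv.2 v'
  obtain ⟨w, rfl⟩ := hv.2 w'
  exact h u w hC

/-- **THE TORSION CLAUSE OF THE MODULI READING, DISCHARGED FACTORWISE.**  With a cyclic vector `v` (`x ↦ act(x)·v` bijective), `(r : matrix) = R(t)`
and the adelic lattice hypothesis `ha`: a property `P` holds for all pairs `v′, w′ ∈ ℚ^{2g}` with `a⁻¹·v̂′ ≡ (r·a)⁻¹·ŵ′ (mod ẑ^{2g})` as soon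
as it holds for all `act(u)·v, act(w)·v` with `tᵢ·(uᵢ mod 𝔞ᵢ) = wᵢ mod tᵢ𝔞ᵢ` for every `i` — and conversely.  This is the shape in which
the (18.3a) clauses of the isogeny form of the main theorem (★ R60-28/28b/37) feed the hypothesis `hf` of the moduli reading (T1′, `k = 1`).
[cite: Shimura1998, §18.3 (18.3a) pp. 122–123; §18.6 Thm. 18.6 (2) pp. 124–125] [cite: Milne2005ShimuraVarieties, §6 Thm. 6.11; §12 (63) p. 116; §14 Prop. 14.12 p. 125] -/
theorem forall_congr_imp_iff_forall_ideleMulEquiv_imp {v : Fin g ⊕ Fin g → ℚ}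
    (hv : Function.Bijective fun x : Π i, K i => c.act x v) {a r : GL (Fin g ⊕ Fin g) finAdeleQ}
    {t : Π i, (FiniteAdeleRing (𝓞 (K i)) (K i))ˣ}
    (hr : ((r : GL (Fin g ⊕ Fin g) finAdeleQ) : Matrix (Fin g ⊕ Fin g) (Fin g ⊕ Fin g) finAdeleQ) =
      c.cmRepMatrix fun i => (t i : FiniteAdeleRing (𝓞 (K i)) (K i)))
    {𝔞 : Π i, FractionalIdeal (𝓞 (K i))⁰ (K i)} (h𝔞 : ∀ i, 𝔞 i ≠ 0)
    (ha : ∀ u : Π i, FiniteAdeleRing (𝓞 (K i)) (K i),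
      (∀ j, (((a⁻¹ : GL (Fin g ⊕ Fin g) finAdeleQ) : Matrix (Fin g ⊕ Fin g) (Fin g ⊕ Fin g) finAdeleQ) *ᵥ
          (c.cmRepMatrix u *ᵥ fun j => algebraMap ℚ finAdeleQ (v j))) j ∈ integralFiniteAdeles ℚ) ↔
        ∀ i, u i ∈ idealAdeles (𝔞 i))
    (P : (Fin g ⊕ Fin g → ℚ) → (Fin g ⊕ Fin g → ℚ) → Prop) :
    (∀ v' w' : Fin g ⊕ Fin g → ℚ,
        (∀ j, (((a⁻¹ : GL (Fin g ⊕ Fin g) finAdeleQ) : Matrix (Fin g ⊕ Fin g) (Fin g ⊕ Fin g) finAdeleQ) *ᵥ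
                  (fun j => algebraMap ℚ finAdeleQ (v' j)) -
                (((r * a)⁻¹ : GL (Fin g ⊕ Fin g) finAdeleQ) : Matrix (Fin g ⊕ Fin g) (Fin g ⊕ Fin g) finAdeleQ) *ᵥ
                  (fun j => algebraMap ℚ finAdeleQ (w' j))) j ∈ integralFiniteAdeles ℚ) →
          P v' w') ↔
      ∀ u w : Π i, K i,
        (∀ i, ideleMulEquiv (t i) (𝔞 i) (h𝔞 i) (Submodule.Quotient.mk (u i)) = Submodule.Quotient.mk (w i)) →
          P (c.act u v) (c.act w v) := by
  rw [c.forall_imp_iff_forall_act_imp_of_bijective hv]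
  refine forall_congr' fun u => forall_congr' fun w => ?_
  rw [c.forall_inv_mulVec_act_sub_mem_iff_ideleMulEquiv hr h𝔞 ha u w]

end CMStructure

end Literature.AlgebraicGeometry.ModuliOfAbelianVarieties

end
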